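import Literature.AlgebraicGeometry.Motives.AbelianVarietyPoincareOrthogonal
import Literature.AlgebraicGeometry.Motives.AbelianVarietyTheoremOfCubeProofs
import Literature.AlgebraicGeometry.Motives.AbelianVarietyProjectiveChart
import Literature.AlgebraicGeometry.Motives.AbelianVarietyProduct
import Literature.AlgebraicGeometry.Motives.AbelianVarietyProductDimProofs
import HarnessLib

/-!
# Poincaré's complete reducibility theorem over an algebraically closed field
# (Mumford, *Abelian Varieties*, §19, Thm. 1) — unconditionally

Let `K` be an algebraically closed field and `i : Y ↪ X` an abelian subvariety (a homomorphism of
abelian varieties which is a closed immersion). **Then there is an abelian subvariety `j : Z ↪ X`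
such that `(i, j) : Y × Z → X`, `(y, z) ↦ i(y) + j(z)`, is an isogeny** (Mumford, *Abelian
Varieties*, §19, Thm. 1, p. 173; Milne 1986, Prop. 12.1). This is the hypothesis `hP1` of the
finite-field and number-field Tate assemblies of this directory
(`tate_bijective_of_finite_of_pseudoCoherent_general_of_poincare_algebraicClosure`,
`Motives/AbelianVarietyEndGaloisFinite`; `module_finite_hom_of_theoremOfCube_of_poincare`, …), proved
here as a THEOREM:

* `AbelianVariety.poincare_complete_reducibility` — the statement above, for every abelian
  subvariety (no dimension hypotheses);
* `AbelianVariety.poincare_hP1` — the same in the exact shape `hP1` quantified over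
  `AbelianVariety L` for any algebraically closed `L` (in particular `L = AlgebraicClosure K`).

Proof (Mumford's, pp. 173–174, in the dual-free form prepared in
`Motives/AbelianVarietyPoincareOrthogonal`): take `L` ample on `X`
(`exists_isAmple_symmetric_holds`, `Motives/AbelianVarietyProjectiveChart`) and let
`N = Y^⊥ = {x ; (t_x^* L - L)|_Y ∼ 0}` (`orth i L`), a closed subset whose `K`-points form a subgroup
(`mem_ker_Phi_iff`); let `Z` be its identity component (`Motives/AbelianVarietyIdentityComponent`,
`redSub`), an abelian subvariety with `N` a finite union of translates of `Z`. Then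
`dim X ≤ dim Y + dim Z` (`dim_le_dim_add_dim_of_orth_subset`, the torsion count replacing
`dim Y^∨ = dim Y`) and `Y ∩ N` is finite (`finite_preimage_orth`). Hence the homomorphism
`σ = p₁ ≫ i + p₂ ≫ j : Y × Z → X` has finitely many `K`-points in its kernel (a kernel point
`(y, z)` has `i(y) = j(z)⁻¹ ∈ Y ∩ N`, and `y` determines `z` as `j` is a monomorphism), so its
kernel is zero-dimensional (`topologicalKrullDim_ker_le_zero_of_finite`: the closed points of the
kernel are `K`-rational, Mathlib `JacobsonSpace.discreteTopology`), so
`dim (Y × Z) = dim σ(Y × Z) ≤ dim X ≤ dim Y + dim Z = dim (Y × Z)` (dimension formula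
`dim_eq_dim_add_topologicalKrullDim_ker` for `Y × Z ↠ im σ`), the closed immersion `im σ ↪ X` is
surjective (`dim_lt_of_isClosedImmersion_of_not_surjective`), `σ` is surjective, and a surjective
homomorphism between abelian varieties of the same dimension is an isogeny
(`isIsogeny_of_surjective_of_dim_eq`). Finally `biprod.desc i j = (Y ⊞ Z ≅ Y × Z) ≫ σ` (`biprod_desc_eq_comp_sum`).

The seesaw/cube inputs of `Motives/AbelianVarietyPoincareOrthogonal` (`hA`, `hB`, `hC`) are the
theorems `seesaw_isClosed_trivialLocus_of_pseudoCoherent_general`,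
`seesaw_exists_linEquiv_classPullback_of_pseudoCoherent_general`,
`theoremOfCube_isOpen_trivialLocus_of_pseudoCoherent_general` (`Motives/AbelianVarietyTheoremOfCubeProofs`)
applied to `cechComplex_pseudoCoherent_general_holds` (`Motives/CechComplexPseudoCoherentGeneralProofs`),
so the results of this file are unconditional. No named facts are introduced.

Also proved on the way (for a homomorphism `g : P → Q` over `K = K̄` whose kernel has finitely many
`K`-points): `topologicalKrullDim_ker_le_zero_of_finite`, `dim_eq_dim_image_of_finite`
(`dim P = dim (im g)`), `isIsogeny_of_finite_of_dim_le` (`dim Q ≤ dim P ⇒ g` is an isogeny).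

Mathlib searched (pin): `JacobsonSpace.discreteTopology`, `JacobsonSpace.of_isClosedEmbedding`,
`topologicalKrullDim_zero_of_discreteTopology`, `LocallyOfFiniteType.jacobsonSpace`,
`Set.Finite.of_finite_image`, `biprod.desc_eq`, `CartesianMonoidalCategory.hom_ext` (used); Mathlib has
no abelian varieties.

## References

* D. Mumford, *Abelian Varieties*, TIFR Studies in Mathematics 5, OUP (1970): §19, Thm. 1
  (complete reducibility theorem of Poincaré) and its proof, pp. 173–174. [MumfordAV1970]
* J. S. Milne, *Abelian Varieties*, in: G. Cornell, J. H. Silverman (eds.), *Arithmetic Geometry*,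
  Springer (1986): Prop. 12.1 and its proof (held copy `book:cornellnd-arithmetic-geometry`, PDF p. 189).
  [Milne1986AbelianVarieties]
* J. Tate, *Endomorphisms of abelian varieties over finite fields*, Invent. Math. 2 (1966), 134–144:
  the use of Poincaré's theorem in the proof of the Main Theorem (§1, semisimplicity of `End⁰`).
  [Tate1966Endomorphisms]
-/

noncomputable section

universe u

open CategoryTheory CategoryTheory.Limits AlgebraicGeometry MonoidalCategory CartesianMonoidalCategory
open TopologicalSpace Topology

namespace Literature.AlgebraicGeometry.Motives

namespace AbelianVariety

open scoped MonObj

/-! ### Homomorphisms whose kernel has finitely many rational points -/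

section FiniteKernel

variable {K : Type u} [Field K] [IsAlgClosed K] {P Q : AbelianVariety K} (g : P ⟶ Q)

/-- **A kernel with finitely many `K`-points is zero-dimensional** (`K` algebraically closed): the
closed points of `Ker g ↪ P` are closed points of `P`, hence `K`-rational points of `P` killed by `g`
(`pointOfClosed`, `comp_eq_one_of_apply_mem`); if these are finite in number, the Jacobson space `Ker g`
(of finite type over `K`) has finitely many closed points, hence is discrete
(Mathlib `JacobsonSpace.discreteTopology`) and of Krull dimension `≤ 0`. [folklore] -/
theorem topologicalKrullDim_ker_le_zero_of_finite
    (hfin : {R : P.Points K | R ≫ g.hom.hom.hom = 1}.Finite) :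
    topologicalKrullDim ↥(Hom.ker g) ≤ 0 := by
  haveI : IsClosedImmersion (Hom.kerι g) := MorphismProperty.pullback_fst _ _ inferInstance
  haveI : JacobsonSpace P.X.left := LocallyOfFiniteType.jacobsonSpace P.X.hom
  haveI : JacobsonSpace ↥(Hom.ker g) := .of_isClosedEmbedding (Hom.kerι g).isClosedEmbedding
  have hcl : (closedPoints ↥(Hom.ker g)).Finite := by
    have key : ∀ x ∈ closedPoints ↥(Hom.ker g), IsClosed ({(Hom.kerι g) x} : Set P.X.left) :=
      fun x hx => by
        rw [← Set.image_singleton]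
        exact (Hom.kerι g).isClosedEmbedding.isClosedMap _ hx
    have hpt : ∀ x (hx : x ∈ closedPoints ↥(Hom.ker g)),
        (P.pointOfClosed ((Hom.kerι g) x) (key x hx)).left (IsLocalRing.closedPoint K) =
          (Hom.kerι g) x := fun x hx => P.pt_pointOfClosed _ _
    have hmem : ∀ x (hx : x ∈ closedPoints ↥(Hom.ker g)),
        P.pointOfClosed ((Hom.kerι g) x) (key x hx) ≫ g.hom.hom.hom = 1 := fun x hx => by
      apply comp_eq_one_of_apply_mem g
      rw [hpt x hx, kerSet_eq_range_kerι]
      exact ⟨x, rfl⟩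
    haveI := hfin.to_subtype
    let F : closedPoints ↥(Hom.ker g) → {R : P.Points K | R ≫ g.hom.hom.hom = 1} := fun x =>
      ⟨P.pointOfClosed ((Hom.kerι g) x.1) (key x.1 x.2), hmem x.1 x.2⟩
    refine Set.finite_coe_iff.1 (Finite.of_injective F fun x x' h => ?_)
    apply Subtype.ext
    apply (Hom.kerι g).isClosedEmbedding.injective
    have h' := congrArg
      (fun R : {R : P.Points K | R ≫ g.hom.hom.hom = 1} => R.1.left (IsLocalRing.closedPoint K)) h
    rw [← hpt x.1 x.2, ← hpt x'.1 x'.2]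
    exact h'
  haveI := JacobsonSpace.discreteTopology hcl
  exact topologicalKrullDim_zero_of_discreteTopology _

/-- **`dim P = dim (im g)` when the kernel of `g : P → Q` has finitely many `K`-points**: the
dimension formula `dim P = dim (im g) + dim Ker (P ↠ im g)` (`dim_eq_dim_add_topologicalKrullDim_ker`)
with the kernel of `P ↠ im g` zero-dimensional (it has the same rational points as `Ker g`, since
`im g ↪ Q` is a monomorphism on points). [folklore] -/
theorem dim_eq_dim_image_of_finite (hfin : {R : P.Points K | R ≫ g.hom.hom.hom = 1}.Finite) :
    P.dim = (image g).dim := by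
  have hfin' : {R : P.Points K | R ≫ (toImage g).hom.hom.hom = 1}.Finite := by
    refine hfin.subset fun R hR => ?_
    simp only [Set.mem_setOf_eq] at hR ⊢
    have e : g.hom.hom.hom = (toImage g).hom.hom.hom ≫ (imageι g).hom.hom.hom :=
      congrArg (fun f => f.hom.hom.hom) (toImage_imageι g).symm
    rw [e, ← Category.assoc, hR, MonObj.one_comp]
  have hd := dim_eq_dim_add_topologicalKrullDim_ker (toImage g)
  have h0 := topologicalKrullDim_ker_le_zero_of_finite (toImage g) hfin'
  induction hdk : topologicalKrullDim ↥(Hom.ker (toImage g)) using WithBot.recBotCoe with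
  | bot =>
    exfalso
    rw [hdk, WithBot.add_bot] at hd
    exact WithBot.coe_ne_bot hd
  | coe d =>
    rw [hdk] at hd h0
    have hd0 : d = 0 := by
      have h0' : (d : WithBot ℕ∞) ≤ ((0 : ℕ∞) : WithBot ℕ∞) := h0
      exact nonpos_iff_eq_zero.1 (WithBot.coe_le_coe.1 h0')
    subst hd0
    rw [WithBot.coe_zero, add_zero] at hd
    exact_mod_cast hd

/-- **A homomorphism with finitely many `K`-points in its kernel onto an abelian variety of no larger
dimension is an isogeny**: `dim (im g) = dim P ≥ dim Q`, so the closed immersion `im g ↪ Q` is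
surjective (`dim_lt_of_isClosedImmersion_of_not_surjective`), hence `g` is surjective between abelian
varieties of the same dimension (`isIsogeny_of_surjective_of_dim_eq`).
[cite: MumfordAV1970, §19 Thm. 1 (proof, p. 174)] -/
theorem isIsogeny_of_finite_of_dim_le (hfin : {R : P.Points K | R ≫ g.hom.hom.hom = 1}.Finite)
    (hdim : Q.dim ≤ P.dim) : IsIsogeny g := by
  have h1 := dim_eq_dim_image_of_finite g hfin
  have h2 := dim_image_le_right g
  have hsurjι : Function.Surjective (Hom.toSchemeHom (imageι g)) := by
    by_contra hns
    have h3 := dim_lt_of_isClosedImmersion_of_not_surjective (imageι g) hns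
    omega
  haveI : Surjective (Hom.toSchemeHom g) := ⟨by
    rw [← toImage_imageι g]
    change Function.Surjective (Hom.toSchemeHom (toImage g) ≫ Hom.toSchemeHom (imageι g))
    rw [Scheme.Hom.comp_base]
    exact hsurjι.comp (surjective_toSchemeHom_toImage g).1⟩
  exact isIsogeny_of_surjective_of_dim_eq g (by omega)

omit [IsAlgClosed K] in
/-- An isomorphism of abelian varieties is an isogeny (its underlying morphism of schemes is an
isomorphism). [folklore] -/
theorem isIsogeny_hom_of_iso {X Y : AbelianVariety K} (e : X ≅ Y) : IsIsogeny e.hom := by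
  haveI : IsIso (Hom.toSchemeHom e.hom) :=
    ⟨Hom.toSchemeHom e.inv,
      by
        change Hom.toSchemeHom (e.hom ≫ e.inv) = _
        rw [e.hom_inv_id]; rfl,
      by
        change Hom.toSchemeHom (e.inv ≫ e.hom) = _
        rw [e.inv_hom_id]; rfl⟩
  exact ⟨inferInstance, inferInstance⟩

end FiniteKernel

/-! ### The sum homomorphism `Y × Z → X` of two abelian subvarieties -/

section Sum

variable {K : Type u} [Field K] {X Y Z : AbelianVariety K} (i : Y ⟶ X) (j : Z ⟶ X)

/-- `biprod.desc i j` is the sum homomorphism `σ = p₁ ≫ i + p₂ ≫ j : Y × Z → X`,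
`(y, z) ↦ i(y) j(z)`, transported along `Y ⊞ Z ≅ Y × Z`. [folklore] -/
theorem biprod_desc_eq_comp_sum :
    biprod.desc i j = (biprodIsoProd Y Z).hom ≫ (fst Y Z ≫ i + snd Y Z ≫ j) := by
  rw [Preadditive.comp_add, ← Category.assoc, ← Category.assoc, biprodIsoProd_hom_fst,
    biprodIsoProd_hom_snd, biprod.desc_eq]

/-- The value of the sum homomorphism `σ = p₁ ≫ i + p₂ ≫ j` at a `T`-valued point `R = (y, z)` of
`Y × Z`: `σ(R) = i(y) · j(z)`. [folklore] -/
theorem comp_sum_hom {T : SchemeOver K} (R : T ⟶ (Y.prod Z).X) :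
    R ≫ (fst Y Z ≫ i + snd Y Z ≫ j).hom.hom.hom =
      (R ≫ CartesianMonoidalCategory.fst Y.X Z.X ≫ i.hom.hom.hom) *
        (R ≫ CartesianMonoidalCategory.snd Y.X Z.X ≫ j.hom.hom.hom) := by
  rw [hom_hom_hom_add, MonObj.comp_mul]
  rfl

end Sum

/-! ### Poincaré's complete reducibility theorem -/

section Poincare

variable {K : Type u} [Field K] [IsAlgClosed K] {X Y : AbelianVariety K} (i : Y ⟶ X)
  [IsClosedImmersion (Hom.toSchemeHom i)]

/-- **Poincaré's complete reducibility theorem** (Mumford, *Abelian Varieties*, §19, Thm. 1; Milne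
1986, Prop. 12.1) over an algebraically closed field: for an abelian subvariety `i : Y ↪ X` there is
an abelian subvariety `j : Z ↪ X` — the identity component of the orthogonal `Y^⊥` of `Y` with
respect to an ample divisor — such that `(i, j) : Y ⊞ Z → X` is an isogeny.
[cite: MumfordAV1970, §19 Thm. 1 (pp. 173–174)] [cite: Milne1986AbelianVarieties, Prop. 12.1 (PDF p. 189)] -/
theorem poincare_complete_reducibility :
    ∃ (Z : AbelianVariety K) (j : Z ⟶ X),
      IsClosedImmersion (Hom.toSchemeHom j) ∧ IsIsogeny (biprod.desc i j) := by
  classical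
  -- the cube / seesaw inputs, now theorems
  have hA : seesaw_isClosed_trivialLocus.{u} :=
    seesaw_isClosed_trivialLocus_of_pseudoCoherent_general cechComplex_pseudoCoherent_general_holds
  have hB : seesaw_exists_linEquiv_classPullback.{u} :=
    seesaw_exists_linEquiv_classPullback_of_pseudoCoherent_general
      cechComplex_pseudoCoherent_general_holds
  have hC : theoremOfCube_isOpen_trivialLocus.{u} :=
    theoremOfCube_isOpen_trivialLocus_of_pseudoCoherent_general cechComplex_pseudoCoherent_general_holds
  have hcube : X.cubicalStructure_linEquiv := X.cubicalStructure_linEquiv_of_seesaw hA hB hC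
  -- an ample divisor `L` on `X` and a class map on `Y`
  obtain ⟨L, hL, -⟩ := (exists_isAmple_symmetric_holds : X.exists_isAmple_symmetric)
  obtain ⟨Q, _, cl, hadd, heq⟩ := CartierDivisor.exists_classMap Y.X.left
  -- the orthogonal `N = Y^⊥`, a closed subset whose rational points form the subgroup `ker Φ`
  set N : Set X.X.left := orth i L with hNdef
  have hN : IsClosed N := isClosed_orth i L hA
  have hmem : ∀ P : X.Points K, P.left (IsLocalRing.closedPoint K) ∈ N ↔
      P ∈ (Phi i L hadd heq hcube).ker := fun P => (mem_ker_Phi_iff i L hadd heq hcube P).symm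
  have h1N : origin X ∈ N := by
    rw [← one_left_closedPoint, hmem]
    exact one_mem _
  have hNmul : ∀ P P' : X.Points K, P.left (IsLocalRing.closedPoint K) ∈ N →
      P'.left (IsLocalRing.closedPoint K) ∈ N → (P * P').left (IsLocalRing.closedPoint K) ∈ N := by
    intro P P' hP hP'
    rw [hmem] at hP hP' ⊢
    exact mul_mem hP hP'
  have hNinv : ∀ P : X.Points K, P.left (IsLocalRing.closedPoint K) ∈ N →
      P⁻¹.left (IsLocalRing.closedPoint K) ∈ N := by
    intro P hP
    rw [hmem] at hP ⊢
    exact inv_mem hP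
  -- its identity component `Z = X_C`
  obtain ⟨C, hCi, h1C, hCN, hmax⟩ := exists_maximal_irreducible_origin_mem hN h1N
  have hδ := range_divMor_subset_of_maximal' hN hNmul hNinv C hCi h1C hCN hmax
  obtain ⟨I, hI, Qk, -, hcov⟩ :=
    exists_finite_subset_iUnion_translation hN hNmul hNinv C hCi h1C hCN hmax
  haveI := hI
  set Z := redSub C hCi h1C hδ with hZdef
  set j : Z ⟶ X := redSubHom C hCi h1C hδ with hjdef
  -- `dim X ≤ dim Y + dim Z` and `Y ∩ N` finite
  have hdim : X.dim ≤ Y.dim + Z.dim := dim_le_dim_add_dim_of_orth_subset hA hB hC hCi h1C hδ Qk hcov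
  have hYN : ((Hom.toSchemeHom i) ⁻¹' N).Finite := finite_preimage_orth i L hA hB hcube hL
  refine ⟨Z, j, inferInstance, ?_⟩
  -- the kernel of `σ : Y × Z → X` has finitely many rational points
  have hker : {R : (Y.prod Z).Points K | R ≫ (fst Y Z ≫ i + snd Y Z ≫ j).hom.hom.hom = 1}.Finite := by
    let y : (Y.prod Z).Points K → Y.Points K := fun R => R ≫ CartesianMonoidalCategory.fst Y.X Z.X
    let b : (Y.prod Z).Points K → Z.Points K := fun R => R ≫ CartesianMonoidalCategory.snd Y.X Z.X
    have hval : ∀ R : (Y.prod Z).Points K, R ≫ (fst Y Z ≫ i + snd Y Z ≫ j).hom.hom.hom =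
        (y R ≫ i.hom.hom.hom) * (b R ≫ j.hom.hom.hom) := fun R => comp_sum_hom i j R
    refine Set.Finite.of_finite_image (f := fun R => (y R).left (IsLocalRing.closedPoint K))
      (hYN.subset ?_) ?_
    · rintro _ ⟨R, hR, rfl⟩
      simp only [Set.mem_setOf_eq] at hR
      rw [hval] at hR
      have hy : y R ≫ i.hom.hom.hom = (b R)⁻¹ ≫ j.hom.hom.hom := by
        rw [GrpObj.inv_comp]
        exact eq_inv_of_mul_eq_one_left hR
      show (Hom.toSchemeHom i) ((y R).left (IsLocalRing.closedPoint K)) ∈ N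
      rw [← Scheme.Hom.comp_apply]
      change (y R ≫ i.hom.hom.hom).left (IsLocalRing.closedPoint K) ∈ N
      rw [hy]
      exact hCN (comp_redSubι_left_apply_mem C (show Z.Points K from (b R)⁻¹) _)
    · intro R hR R' hR' hRR'
      simp only [Set.mem_setOf_eq] at hR hR'
      have hyy : y R = y R' := Y.eq_of_left_closedPoint_eq _ _ hRR'
      have hbb : b R = b R' := by
        rw [hval] at hR hR'
        have e1 : b R ≫ j.hom.hom.hom = (y R ≫ i.hom.hom.hom)⁻¹ := eq_inv_of_mul_eq_one_right hR
        have e2 : b R' ≫ j.hom.hom.hom = (y R' ≫ i.hom.hom.hom)⁻¹ := eq_inv_of_mul_eq_one_right hR'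
        apply comp_redSubHom_injective hCi h1C hδ
        change b R ≫ j.hom.hom.hom = b R' ≫ j.hom.hom.hom
        rw [e1, e2, hyy]
      exact CartesianMonoidalCategory.hom_ext _ _ hyy hbb
  -- hence `σ` is an isogeny, and so is `biprod.desc i j = (Y ⊞ Z ≅ Y × Z) ≫ σ`
  have hσ : IsIsogeny (fst Y Z ≫ i + snd Y Z ≫ j) :=
    isIsogeny_of_finite_of_dim_le _ hker (by rw [dim_prod]; exact hdim)
  rw [biprod_desc_eq_comp_sum]
  exact isIsogeny_comp (isIsogeny_hom_of_iso (biprodIsoProd Y Z)) hσ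

end Poincare

/-- **Poincaré's complete reducibility theorem in the shape `hP1`** of the Tate / Faltings assemblies
of this directory (`tate_bijective_of_finite_of_pseudoCoherent_general_of_poincare_algebraicClosure`,
`module_finite_hom_of_theoremOfCube_of_poincare`, …), over any algebraically closed field `L`
(e.g. `L = AlgebraicClosure K`); the dimension hypotheses are not needed.
[cite: MumfordAV1970, §19 Thm. 1 (pp. 173–174)] -/
theorem poincare_hP1 (L : Type u) [Field L] [IsAlgClosed L] :
    ∀ (X Y : AbelianVariety L) (i : Y ⟶ X), IsClosedImmersion (Hom.toSchemeHom i) →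
      0 < Y.dim → Y.dim < X.dim →
      ∃ (Z : AbelianVariety L) (j : Z ⟶ X),
        IsClosedImmersion (Hom.toSchemeHom j) ∧ IsIsogeny (biprod.desc i j) :=
  fun _ _ i hi _ _ => @poincare_complete_reducibility L _ _ _ _ i hi

end AbelianVariety

end Literature.AlgebraicGeometry.Motives
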